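/-
Copyright: lit-balaban Phase-2 proof seat p30 (gen 5).  Statement-level skeleton of a published paper; no proof claims beyond what
the kernel checks below.
-/
import Literature.MathematicalPhysics.QuantumFieldTheory.BalabanImbrieJaffe1984to88.BIJ85Eq611Proof
import Literature.MathematicalPhysics.QuantumFieldTheory.BalabanImbrieJaffe1984to88.BIJ85Prop521Proof

/-!
# `BalabanImbrieJaffe1984to88.BIJ85Eq611Structural` — T. Bałaban, J. Imbrie, A. Jaffe, *Renormalization of the Higgs model:
minimizers, propagators and the stability of mean field theory*, Commun. Math. Phys. **97** (1985) 299–329 [BalabanImbrieJaffe1985]: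
Sect. 6.1 *"σ_k = σ_{k+1} + Fluctuation Form"* — **(6.1.1) with its printed inputs DISCHARGED at the operator level**: the
hypotheses (4.2.2), (4.3.1), (5.3.1), (5.2.1), Q^eQ^e_k = Q^e_{k+1}, the symmetry of G_{k,Ax}, all adjoint pairs and Proposition A3
(A15)–(A16) of gen 1's `BIJ85Eq611Proof.eq611` are THEOREMS for the concrete operators σ_k = Q^e_k(I − ∂G_{k,Ax}∂^*)Q^{e*}_k
(`BIJ85SigmaForm421.sigmaOp`), G_{k,Ax} (`BIJ85AxialPropagator411.axialPropagator`), H_{k,Ax} (`BIJ85UnitPropagator433.Hop`),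
Δ_k = (∂H_{k,Ax})^*(∂H_{k,Ax}) (`BIJ85UnitPropagator433.deltaOp`) and C^{(k)} (`BIJ85UnitPropagator433.unitPropagator`, (4.3.3))

statement-level skeleton of published theorems with citation tags; proofs where landed; nothing here is a claim about the Yang–Mills mass gap

PDF held: `paper:balaban1985-cmp97-bij-higgs-minimizers` (journal page = PDF page + 298).  Pages read as images: pp. 318–319
[PDF 20–21] (`HOME/lit-balaban-r15/pages/1985-cmp97-bij-higgs-minimizers-p020-x2.png`, `…-p021-x2.png`), pp. 309–311, 316
(`run/shared/lean/pub/pub-balaban/t4/b2b-balaban-t4-lit2/renders/bij1985/…-p011,p012,p013,p018-x2.png`).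

CITATION HEADER (lean-in-tree rule).  Part of the lit-balaban TYPED SKELETON (HOME `run/shared/lean/pub/lit-balaban/`), Phase-2
seat p30 (gen 5), unit `lit-balaban-p30`; WHAT IS REPRODUCED = rows **C1.Eq6.1.1** and **C1.Eq6.1.2-6.1.9** of `HOME/SKELETON.md`
(reader file `HOME/lit-balaban-r15/ROWS-C1.md`) — the «model instance» companion of gen 1's `BIJ85Eq611Proof` (p243211, which PROVES
(6.1.1) over five abstract inner product spaces *from the printed inputs entered as hypotheses*).  Sibling file `BIJ85Eq611Torus`
puts the result on the tori of the series.

THE PRINTED TEXT (verbatim, pp. 318–319 [PDF 20–21]): *"6.1. σ_k = σ_{k+1} + Fluctuation Form.  The goal here is to show that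
⟨f^{(k)}, σ_k f^{(k)}⟩ = 𝒮_L^{−1}⟨f^{(k+1)}, σ_{k+1} f^{(k+1)}⟩ + ⟨B, Δ_kB⟩. (6.1.1) … Use definition (4.3.1) of Δ_k and the
representation (4.2.2) for σ_k. In addition, note that Q^eQ^e_k = Q^e_{k+1}. … By (5.3.1), H_{k,Ax} = Q^{s*}_k − G_{k,Ax}∂^*Q^{e*}_k∂.
Apply ∂ to this identity, and use the gauge invariance statement ∂H_{k,Ax} = ∂H_k (6.1.4) and the identity ∂Q^{s*}_k = Q^{e*}_k∂.
… The minimum of the form is given by Proposition A3 of the Appendix, namely B′ = −L^{−d/2}C^{(k)}H_k^*∂^*Q^{e*}_{k+1}f^{(k+1)}.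
(6.1.7) The proposition is applicable with ℋ₀ the subspace of axial gauge configurations defined by the k^{th} axial gauge delta
function δ_{k,Ax}(B′) and the delta function δ(QB′). The covariance C of the proposition then agrees with C^{(k)} defined in (4.3.3),
and this is also the covariance in (6.1.7). Furthermore, the translation B′ = B − L^{−d/2}C^{(k)}H_k^*∂^*Q^{e*}_{k+1}f^{(k+1)} (6.1.8)
and the decomposition (A16) yield … (6.1.9) Using (6.1.4) and the representation (5.1.15) [= (5.2.1), gen 1 transcript note T1],
we can rewrite (6.1.9) as ⟨f^{(k)},σ_kf^{(k)}⟩ = ⟨B,Δ_kB⟩ + 𝒮_L^{−1}⟨f^{(k+1)},σ_{k+1}f^{(k+1)}⟩, where the scaling 𝒮_L absorbs the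
factor L^{−d} and where σ_{k+1} = Q^e_{k+1}(I − ∂G_{k+1,Ax}∂^*)Q^{e*}_{k+1}. This verifies the inductive hypothesis."*

THE SETTING (seat p09's Euclidean encoding, as in `BIJ85SigmaForm421`/`BIJ85UnitPropagator433`/`BIJ85Prop521Proof`): `E` = η-lattice
bond fields, `F` = η-lattice plaquette fields (finite-dimensional real inner product spaces), `D : E → F` the curl ∂ (its adjoint
`LinearMap.adjoint D` = ∂^*), `V ⊆ E` the level-(k+1) constraint subspace δ(Q_{k+1}A)δ_{k+1,Ax}(A) and `V′ ⊆ E` the level-k one,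
`E₁` = unit-lattice (`T^{(k)}`) bond fields with `W ⊆ E₁` the unit-step constraint subspace δ(QB′)δ_{Ax}(B′) (the ℋ₀ of the quoted
sentence), `Qc : E → E₁` = Q_k, `Qs : E₁ → E` = Q^{s*}_k, `F′` = unit-lattice plaquette fields with `Qes : F′ → F` = Q^{e*}_k and
`d₁ : E₁ → F′` the unit-lattice curl, `F″` = L-lattice (`T^{(k+1)}`) plaquette fields with the one-step `Qes1 : F″ → F′` = Q^{e*}
(so Q^{e*}_{k+1} = Q^{e*}_kQ^{e*} = `Qes ∘ₗ Qes1`, the adjoint of the quoted *"Q^eQ^e_k = Q^e_{k+1}"*).  The operators of the text are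
then DEFINED, not assumed: σ_k := `sigmaOp V′ D Qes`, σ_{k+1} := `sigmaOp V D (Qes ∘ₗ Qes1)` (the last display of p. 319),
G_{k,Ax} := `axialPropagator V′ D`, G_{k+1,Ax} := `axialPropagator V D`, H_{k,Ax} := `Hop V′ D Qs`, Δ_k := `deltaOp V′ D Qs`,
C^{(k)} := `unitPropagator V′ D Qs W`; every `^*` is `LinearMap.adjoint`.  REMAINING INPUTS (named, explicit): the no-zero-modes
claim of p. 309 at level k+1 (`hD`), the structure of the constraint tower *"δ(Q_kA)δ_{k,Ax}(A) = ∫𝒟Bδ(QB)δ(Q_{k−1}A − B)δ_{Ax}(B)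
δ_{k−1,Ax}(A)"* p. 316 (`hQ` Q_kQ^{s*}_k = I, `hV′`, `hV` — exactly the hypotheses of `BIJ85Prop521Proof.eq521`), the identity
∂Q^{s*}_k = Q^{e*}_k∂ (`hdQ`), and the gauge invariance statement (6.1.4) ∂H_k = ∂H_{k,Ax} (`h614`) for the linear map `Hk` playing
H_k (for `Hk := Hop V′ D Qs` it is `rfl`, `eq611_structural_ax`).  All four are theorems on the tori (sibling file).

WHAT IS PROVED.  `Hop_eq_531` ((5.3.1) for the operators, = gen 1's hypothesis `h531`); `D_Hop_apply` ((6.1.5)-shape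
∂H_{k,Ax} = (I − ∂G_{k,Ax}∂^*)∂Q^{s*}_k); `inner_d1_sigmaOp_d1` ((4.3.1) as the BILINEAR identity ⟨∂b, σ_k∂b′⟩ = ⟨b, Δ_kb′⟩ = `h431`);
`eqA15A16_unit` (Proposition A3 (A15)–(A16) = `BIJ85AppAStatements.ConstrainedForm.EqA15A16` for {ℋ = E₁, ℋ₀ = W, Δ = Δ_k,
C = C^{(k)}} — *"The covariance C of the proposition then agrees with C^{(k)} defined in (4.3.3)"* — from the Euler–Lagrange equation of
C^{(k)} = the (4.1.1)-type second moment one scale up, `BIJ85Prop521Proof.inner_D_axialPropagator`, no zero modes of ∂H_{k,Ax} on W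
DERIVED `BIJ85Prop521Proof.noZeroModes_DH`); **`eq611_structural`** = (6.1.1) `⟨f^{(k)},σ_kf^{(k)}⟩ = L^{−d}⟨f^{(k+1)},σ_{k+1}f^{(k+1)}⟩
+ ⟨B,Δ_kB⟩` for f^{(k)} = ∂B′ + L^{−d/2}Q^{e*}f^{(k+1)} ((6.4)), B′ ∈ W, B = (6.1.8), with l = L^{−d/2}; `eq611_structural_ax` (H_k :=
H_{k,Ax}); `transl_eq_of_614` (by (5.2.8) the translation (6.1.8) is the same vector for every H_k obeying (6.1.4)).
D-0026: no `def`, no new named fact; theorems only.  Unit `lit-balaban-p30` (literature-prover-lit-balaban-p30-g5-0), 2026-08-21.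
-/

open scoped RealInnerProductSpace

namespace Literature.MathematicalPhysics.QuantumFieldTheory.BalabanImbrieJaffe1984to88.BIJ85Eq611Structural

open BIJ85AppAStatements BIJ85AxialPropagator411 BIJ85AxialMinimizer413 BIJ85SigmaForm421 BIJ85UnitPropagator433
  BIJ85Prop521Proof

noncomputable section

variable {E F F' F'' : Type*} {E₁ : Type}
  [NormedAddCommGroup E] [InnerProductSpace ℝ E] [FiniteDimensional ℝ E]
  [NormedAddCommGroup F] [InnerProductSpace ℝ F] [FiniteDimensional ℝ F]
  [NormedAddCommGroup E₁] [InnerProductSpace ℝ E₁] [FiniteDimensional ℝ E₁]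
  [NormedAddCommGroup F'] [InnerProductSpace ℝ F'] [FiniteDimensional ℝ F']
  [NormedAddCommGroup F''] [InnerProductSpace ℝ F''] [FiniteDimensional ℝ F'']

/-! ## 1. (5.3.1) and (6.1.5) for the operators -/

omit [FiniteDimensional ℝ E₁] [FiniteDimensional ℝ F'] in
/-- **(5.3.1)** p. 317 [PDF 19], verbatim: *"H_{k,Ax}B = Q^{s*}_kB − G_{k,Ax}∂^*Q^{e*}_k∂B. (5.3.1)"* — for the linear map
`H_{k,Ax} = Hop V′ D Qs` (`B ↦` the minimizing configuration of the class of `Q^{s*}_kB`) this is an OPERATOR IDENTITY once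
`∂Q^{s*}_k = Q^{e*}_k∂` (`hdQ`); it is gen 1's hypothesis `h531` of `BIJ85Eq611Proof.eq611`. [cite: BalabanImbrieJaffe1985, (5.3.1) p.317] -/
theorem Hop_eq_531 (V' : Submodule ℝ E) (D : E →ₗ[ℝ] F) (Qs : E₁ →ₗ[ℝ] E) (Qes : F' →ₗ[ℝ] F) (d₁ : E₁ →ₗ[ℝ] F')
    (hdQ : D ∘ₗ Qs = Qes ∘ₗ d₁) :
    Hop V' D Qs = Qs - axialPropagator V' D ∘ₗ LinearMap.adjoint D ∘ₗ Qes ∘ₗ d₁ := by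
  refine LinearMap.ext fun B => ?_
  have h : D (Qs B) = Qes (d₁ B) := by simpa using LinearMap.congr_fun hdQ B
  simp only [Hop, minOp, LinearMap.comp_apply, LinearMap.sub_apply, LinearMap.id_apply, h]

omit [FiniteDimensional ℝ E₁] in
/-- **(6.1.5)-shape** p. 319: `∂H_{k,Ax}B = (I − ∂G_{k,Ax}∂^*)∂Q^{s*}_kB` — applying ∂ to the definition of the minimizer
(`∂G_{k,Ax}∂^*` = `BIJ85SigmaForm421.curlG`). [cite: BalabanImbrieJaffe1985, (6.1.5) p.319] -/
theorem D_Hop_apply (V' : Submodule ℝ E) (D : E →ₗ[ℝ] F) (Qs : E₁ →ₗ[ℝ] E) (B : E₁) :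
    D (Hop V' D Qs B) = D (Qs B) - curlG V' D (D (Qs B)) := by
  simp only [Hop, minOp, curlG, LinearMap.comp_apply, LinearMap.sub_apply, LinearMap.id_apply, map_sub]

/-! ## 2. (4.3.1) as a bilinear identity -/

/-- **(4.3.1)** p. 311 [PDF 13], verbatim: *"⟨∂B, σ_k∂B⟩ = ⟨B, Δ_kB⟩, (4.3.1) which defines an action Δ_k"* — for σ_k =
Q^e_k(I − ∂G_{k,Ax}∂^*)Q^{e*}_k (4.2.2) and Δ_k = (∂H_{k,Ax})^*(∂H_{k,Ax}) the identity holds as a BILINEAR one,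
`⟨∂b, σ_k∂b′⟩ = ⟨b, Δ_kb′⟩` (gen 1's hypothesis `h431`): `∂G_{k,Ax}∂^*` is a symmetric projection killing nothing but fixing ∂V′,
and ∂Q^{s*}_k = Q^{e*}_k∂ (`hdQ`); no zero modes at level k. [cite: BalabanImbrieJaffe1985, (4.3.1) p.311] -/
theorem inner_d1_sigmaOp_d1 {V' : Submodule ℝ E} {D : E →ₗ[ℝ] F} (hD' : ∀ v : V', D (v : E) = 0 → v = 0)
    (Qs : E₁ →ₗ[ℝ] E) (Qes : F' →ₗ[ℝ] F) (d₁ : E₁ →ₗ[ℝ] F') (hdQ : D ∘ₗ Qs = Qes ∘ₗ d₁) (b b' : E₁) :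
    ⟪d₁ b, sigmaOp V' D Qes (d₁ b')⟫ = ⟪b, deltaOp V' D Qs b'⟫ := by
  have h : ∀ x : E₁, Qes (d₁ x) = D (Qs x) := fun x => by simpa using (LinearMap.congr_fun hdQ x).symm
  -- the curl of the minimizer is orthogonal to ∂V′, in particular to the range of the projection ∂G∂^*
  have horth : ⟪curlG V' D (D (Qs b)), D (Hop V' D Qs b')⟫ = 0 := by
    obtain ⟨v, hv⟩ := curlG_mem_range V' D (D (Qs b))
    rw [hv]
    rw [real_inner_comm]
    exact inner_D_Hop hD' Qs b' v
  rw [inner_deltaOp', D_Hop_apply V' D Qs b, inner_sub_left, horth, sub_zero]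
  simp only [sigmaOp, LinearMap.comp_apply, LinearMap.sub_apply, LinearMap.id_apply, LinearMap.adjoint_inner_right, h,
    D_Hop_apply]

/-! ## 3. Proposition A3 (A15)–(A16) for ℋ₀ = δ(QB′)δ_{Ax}(B′), Δ = Δ_k, C = C^{(k)} -/

/-- **Proposition A3, (A15)–(A16)** p. 328 [PDF 30] (verbatim: *"HB = CB = Z^{−1}∫_{ℋ₀}exp(−½⟨x,Δx⟩ + ⟨x,B⟩)x dx. (A15) is the
minimum configuration of ½⟨x,Δx⟩ − ⟨x,B⟩, x ∈ ℋ₀. Thus with x = y + CB, ½⟨x,Δx⟩ − ⟨x,B⟩ = ½⟨y,Δy⟩ − ½⟨B,CB⟩, x ∈ ℋ₀. (A16)"*)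
AS USED ON p. 319 (*"The proposition is applicable with ℋ₀ the subspace of axial gauge configurations defined by … δ_{k,Ax}(B′) and
the delta function δ(QB′). The covariance C of the proposition then agrees with C^{(k)} defined in (4.3.3)"*): for the constrained form
{ℋ = unit-lattice bond fields, ℋ₀ = W, Δ = Δ_k = (∂H_{k,Ax})^*(∂H_{k,Ax}), C = C^{(k)} = `unitPropagator V′ D Qs W`} the tree's
`ConstrainedForm.EqA15A16` HOLDS (the remaining fields V, Δ₀, G, P of the carrier do not enter (A15)–(A16) and are arbitrary) — from
the Euler–Lagrange equation of the second moment (4.3.3) and the absence of zero modes of ∂H_{k,Ax} on W.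
[cite: BalabanImbrieJaffe1985, Prop. A3 (A15)–(A16) p.328] -/
theorem eqA15A16_unit (V' : Submodule ℝ E) (D : E →ₗ[ℝ] F) (Qs : E₁ →ₗ[ℝ] E) (W : Submodule ℝ E₁)
    (hT : ∀ w : W, D (Hop V' D Qs (w : E₁)) = 0 → w = 0) (V0 Δ0 G0 P0 : E₁ →ₗ[ℝ] E₁) :
    ConstrainedForm.EqA15A16
      { H := E₁, ip := fun x y => ⟪x, y⟫, inH0 := fun x => x ∈ W, Δ := deltaOp V' D Qs, V := V0, Δ₀ := Δ0, G := G0,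
        P := P0, C := unitPropagator V' D Qs W } := by
  intro J
  set T : E₁ →ₗ[ℝ] F := D ∘ₗ Hop V' D Qs with hTdef
  have hT' : ∀ w : W, T (w : E₁) = 0 → w = 0 := fun w hw => hT w (by simpa [hTdef] using hw)
  set c : E₁ := unitPropagator V' D Qs W J with hc
  have hcW : c ∈ W := axialPropagator_mem W T J
  -- Euler–Lagrange: ⟨T c, T x⟩ = ⟨J, x⟩ on W
  have hEL : ∀ x : E₁, x ∈ W → ⟪T c, T x⟫ = ⟪J, x⟫ := fun x hx =>
    inner_D_axialPropagator (V := W) (D := T) hT' J ⟨x, hx⟩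
  have hΔ : ∀ x y : E₁, ⟪x, deltaOp V' D Qs y⟫ = ⟪T x, T y⟫ := fun x y => by
    rw [inner_deltaOp']; rfl
  have hcc : ⟪c, deltaOp V' D Qs c⟫ = ⟪J, c⟫ := by rw [hΔ, hEL c hcW]
  -- (A16)
  have hA16 : ∀ x : E₁, x ∈ W →
      (1 / 2) * ⟪x, deltaOp V' D Qs x⟫ - ⟪x, J⟫ =
        (1 / 2) * ⟪x - c, deltaOp V' D Qs (x - c)⟫ - (1 / 2) * ⟪J, c⟫ := by
    intro x hx
    rw [hΔ, hΔ, map_sub, inner_sub_left, inner_sub_right, inner_sub_right, hEL x hx, real_inner_comm (T c) (T x), hEL x hx,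
      hEL c hcW, real_inner_comm x J]
    ring
  refine ⟨hcW, fun x hx => ?_, fun x hx => hA16 x hx⟩
  -- (A15): the minimum, since Δ_k ≥ 0
  dsimp only
  rw [hA16 x hx, hcc, real_inner_comm c J]
  have h0 : 0 ≤ ⟪x - c, deltaOp V' D Qs (x - c)⟫ := deltaOp_nonneg V' D Qs (x - c)
  linarith

/-! ## 4. (6.1.1) with the printed inputs discharged -/

/-- **(6.1.1)** p. 318 [PDF 20], verbatim: *"⟨f^{(k)}, σ_k f^{(k)}⟩ = 𝒮_L^{−1}⟨f^{(k+1)}, σ_{k+1} f^{(k+1)}⟩ + ⟨B, Δ_kB⟩. (6.1.1)"*,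
p. 319: *"where the scaling 𝒮_L absorbs the factor L^{−d} and where σ_{k+1} = Q^e_{k+1}(I − ∂G_{k+1,Ax}∂^*)Q^{e*}_{k+1}"* — gen 1's
`BIJ85Eq611Proof.eq611` WITH ITS PRINTED-INPUT HYPOTHESES DISCHARGED for the operators of Sect. 4: σ_k := `sigmaOp V′ D Qes`
((4.2.2), so `h422` is `rfl`), σ_{k+1} := `sigmaOp V D (Qes ∘ₗ Qes1)` (`h422′`), Δ_k := `deltaOp V′ D Qs` ((4.3.1) =
`inner_d1_sigmaOp_d1`), H_{k,Ax} := `Hop V′ D Qs` ((5.3.1) = `Hop_eq_531`), G_{k,Ax}, G_{k+1,Ax} := `axialPropagator` (symmetric,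
`BIJ85UnitPropagator433.axialPropagator_symm`; (5.2.1) at k+1 = `BIJ85Prop521Proof.eq521`), C^{(k)} := `unitPropagator V′ D Qs W`
(Prop A3 (A15)–(A16) = `eqA15A16_unit`), Q^e_{k+1} = Q^eQ^e_k as the adjoint of Q^{e*}_{k+1} = Q^{e*}_kQ^{e*}, all `^*` = `LinearMap.adjoint`:
for f^{(k)} = ∂B′ + L^{−d/2}Q^{e*}f^{(k+1)} ((6.4)), B′ ∈ W = δ(QB′)δ_{Ax}(B′), B = B′ + L^{−d/2}C^{(k)}H_k^*∂^*Q^{e*}_{k+1}f^{(k+1)}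
((6.1.8)), l = L^{−d/2}.  Remaining named inputs: no zero modes at level k+1 `hD`, the constraint tower `hQ`/`hV′`/`hV` (as in
`eq521`), ∂Q^{s*}_k = Q^{e*}_k∂ `hdQ`, and (6.1.4) ∂H_k = ∂H_{k,Ax} `h614` for the linear `Hk`. [cite: BalabanImbrieJaffe1985, (6.1.1) p.318] -/
theorem eq611_structural {V V' : Submodule ℝ E} {W : Submodule ℝ E₁} {D : E →ₗ[ℝ] F} {Qc : E →ₗ[ℝ] E₁} {Qs : E₁ →ₗ[ℝ] E}
    (hD : ∀ v : V, D (v : E) = 0 → v = 0) (hQ : ∀ B, Qc (Qs B) = B) (hV' : ∀ v : V', Qc (v : E) = 0)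
    (hV : ∀ A, A ∈ V ↔ Qc A ∈ W ∧ A - Qs (Qc A) ∈ V')
    (Qes : F' →ₗ[ℝ] F) (Qes1 : F'' →ₗ[ℝ] F') (d₁ : E₁ →ₗ[ℝ] F') (hdQ : D ∘ₗ Qs = Qes ∘ₗ d₁)
    (Hk : E₁ →ₗ[ℝ] E) (h614 : D ∘ₗ Hk = D ∘ₗ Hop V' D Qs)
    (l : ℝ) (fL : F'') (B' : E₁) (hB' : B' ∈ W) :
    ⟪d₁ B' + l • Qes1 fL, sigmaOp V' D Qes (d₁ B' + l • Qes1 fL)⟫ =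
      l ^ 2 * ⟪fL, sigmaOp V D (Qes ∘ₗ Qes1) fL⟫
      + ⟪B' + l • unitPropagator V' D Qs W (LinearMap.adjoint Hk (LinearMap.adjoint D (Qes (Qes1 fL)))),
         deltaOp V' D Qs
           (B' + l • unitPropagator V' D Qs W (LinearMap.adjoint Hk (LinearMap.adjoint D (Qes (Qes1 fL)))))⟫ := by
  have hle : V' ≤ V := le_of_factor hV' hV
  have hD' : ∀ v : V', D (v : E) = 0 → v = 0 := noZeroModes_sub hle hD
  -- no zero modes of ∂H_{k,Ax} on W (for C^{(k)}), derived
  have hT : ∀ w : W, D (Hop V' D Qs (w : E₁)) = 0 → w = 0 := by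
    intro w hw
    refine noZeroModes_DH hD hQ hV' hV w ?_
    simpa [Hop_eq_HaxOp] using hw
  -- (5.2.1) at k+1 for the p09 packaging
  have h521 : axialPropagator V D =
      Hop V' D Qs ∘ₗ unitPropagator V' D Qs W ∘ₗ LinearMap.adjoint (Hop V' D Qs) + axialPropagator V' D := by
    rw [prop521_eq521]; exact eq521 hD hQ hV' hV
  exact BIJ85Eq611Proof.eq611 d₁ D (LinearMap.adjoint D) (axialPropagator V' D) (axialPropagator V D)
    (LinearMap.adjoint Qes) Qes (LinearMap.adjoint Qes1) Qes1 (LinearMap.adjoint (Qes ∘ₗ Qes1)) (Qes ∘ₗ Qes1)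
    Hk (Hop V' D Qs) Qs (LinearMap.adjoint Hk) (LinearMap.adjoint (Hop V' D Qs))
    (unitPropagator V' D Qs W) (deltaOp V' D Qs) 0 0 0 0 (fun x => x ∈ W)
    (sigmaOp V' D Qes) (sigmaOp V D (Qes ∘ₗ Qes1))
    (fun a p => (LinearMap.adjoint_inner_right D a p).symm)
    (fun p f => LinearMap.adjoint_inner_left Qes f p)
    (fun f g => LinearMap.adjoint_inner_left Qes1 g f)
    (fun p g => LinearMap.adjoint_inner_left (Qes ∘ₗ Qes1) g p)
    (fun b a => (LinearMap.adjoint_inner_right Hk b a).symm)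
    (fun b a => (LinearMap.adjoint_inner_right (Hop V' D Qs) b a).symm)
    (axialPropagator_symm hD')
    rfl (LinearMap.adjoint_comp Qes Qes1).symm
    (inner_d1_sigmaOp_d1 hD' Qs Qes d₁ hdQ) (Hop_eq_531 V' D Qs Qes d₁ hdQ) h614.symm hdQ h521 rfl
    (eqA15A16_unit V' D Qs W hT 0 0 0 0) l _ fL B' _ hB' rfl rfl

/-- **(6.1.1) with H_k := H_{k,Ax}** — then (6.1.4) is `rfl` and NO printed input of Sect. 6.1 is left as a hypothesis beyond the
standing structure (no zero modes, constraint tower, ∂Q^{s*}_k = Q^{e*}_k∂); by (5.2.8) `H^*_{k,Ax}∂^* = H^*_k∂^*` the translation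
(6.1.8) is the same vector as with the Landau H_k (`transl_eq_of_614`). [cite: BalabanImbrieJaffe1985, (6.1.1) p.318] -/
theorem eq611_structural_ax {V V' : Submodule ℝ E} {W : Submodule ℝ E₁} {D : E →ₗ[ℝ] F} {Qc : E →ₗ[ℝ] E₁} {Qs : E₁ →ₗ[ℝ] E}
    (hD : ∀ v : V, D (v : E) = 0 → v = 0) (hQ : ∀ B, Qc (Qs B) = B) (hV' : ∀ v : V', Qc (v : E) = 0)
    (hV : ∀ A, A ∈ V ↔ Qc A ∈ W ∧ A - Qs (Qc A) ∈ V')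
    (Qes : F' →ₗ[ℝ] F) (Qes1 : F'' →ₗ[ℝ] F') (d₁ : E₁ →ₗ[ℝ] F') (hdQ : D ∘ₗ Qs = Qes ∘ₗ d₁)
    (l : ℝ) (fL : F'') (B' : E₁) (hB' : B' ∈ W) :
    ⟪d₁ B' + l • Qes1 fL, sigmaOp V' D Qes (d₁ B' + l • Qes1 fL)⟫ =
      l ^ 2 * ⟪fL, sigmaOp V D (Qes ∘ₗ Qes1) fL⟫
      + ⟪B' + l • unitPropagator V' D Qs W (LinearMap.adjoint (Hop V' D Qs) (LinearMap.adjoint D (Qes (Qes1 fL)))),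
         deltaOp V' D Qs
           (B' + l • unitPropagator V' D Qs W (LinearMap.adjoint (Hop V' D Qs) (LinearMap.adjoint D (Qes (Qes1 fL)))))⟫ :=
  eq611_structural hD hQ hV' hV Qes Qes1 d₁ hdQ (Hop V' D Qs) rfl l fL B' hB'

omit [FiniteDimensional ℝ F'] [FiniteDimensional ℝ F''] in
/-- **(5.2.8)** p. 316 *"H^*_{j,Ax}∂^* = H^*_j∂^*"* ⇒ the translation (6.1.8) does not depend on which minimizer obeying the gauge
invariance statement (6.1.4) ∂H_k = ∂H_{k,Ax} is used: `C^{(k)}H_k^*∂^*g = C^{(k)}H^*_{k,Ax}∂^*g` (adjoint of (6.1.4), gen 1's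
`BIJ85Eq611Proof.eq528_of_eq614`). [cite: BalabanImbrieJaffe1985, (5.2.8) p.316] -/
theorem transl_eq_of_614 (V' : Submodule ℝ E) (D : E →ₗ[ℝ] F) (Qs : E₁ →ₗ[ℝ] E) (C : E₁ →ₗ[ℝ] E₁) (Hk : E₁ →ₗ[ℝ] E)
    (h614 : D ∘ₗ Hk = D ∘ₗ Hop V' D Qs) (g : F) :
    C (LinearMap.adjoint Hk (LinearMap.adjoint D g)) = C (LinearMap.adjoint (Hop V' D Qs) (LinearMap.adjoint D g)) := by
  have h := BIJ85Eq611Proof.eq528_of_eq614 D (LinearMap.adjoint D) (fun a p => (LinearMap.adjoint_inner_right D a p).symm)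
    Hk (Hop V' D Qs) (LinearMap.adjoint Hk) (LinearMap.adjoint (Hop V' D Qs))
    (fun b a => (LinearMap.adjoint_inner_right Hk b a).symm)
    (fun b a => (LinearMap.adjoint_inner_right (Hop V' D Qs) b a).symm) h614.symm
  have h' := LinearMap.congr_fun h g
  simp only [LinearMap.comp_apply] at h'
  rw [h']

end

end Literature.MathematicalPhysics.QuantumFieldTheory.BalabanImbrieJaffe1984to88.BIJ85Eq611Structural
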